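import Mathlib.Tactic.Linarith
import Mathlib.Tactic.Ring
import Mathlib.Tactic.NormNum
import Mathlib.Tactic.IntervalCases
import Mathlib.Data.Nat.Choose.Basic
import HarnessLib

/-!
# The (0,1) cell of the ι-window, EXCLUSION side, VI: (Nrm) — any two distinct translates of `Θ` on a very general ppav fourfold meet
# in an integral NORMAL surface — via the Jacobian of a general curve of genus 4; arithmetic skeleton

Family `hodge`, layer `Literature/AlgebraicGeometry/HodgeTheory`. Companion to `SemiregularityThetaSecondFundamentalForm.lean` (pv1-g17:
THEOREM 1 `c_K = c_N`, PROPOSITION 4.5 'S_a non-normal ⟹ 2a ∈ X[k], 2 ≤ k ≤ 9') and `SemiregularityIotaWindowVoid.lean` (pv1 gens 11–15), SAME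
dictionary: `X` a ppav fourfold, `Θ` symmetric, `ι = −1`, `S_a = Θ_a ∩ Θ_{−a} = W_{2a} − a` with `W_b := Θ ∩ Θ_b`; on the Jacobian of a curve `C` of genus 4,
`W_b = W₃ ∩ (W₃ + b) ⊂ Pic³(C)`, `g, h` the two trigonal series (`g + h = K`), `C ⊂ ℙ³` the canonical curve. Ladder note
`papers/HodgeConjecture/hodge-weil-ladder` (packet `run/shared/lean/b2b/hodge-weil/`), CLAIM TABLE v27 (LADDER C180) row pv1-g18, report
`b2b-hweil-pv1-g18/H2-ZERO-ONE-6.md`. Def-free, fully proved ELEMENTARY statements (integer / rational bookkeeping); the geometry is in the docstrings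
and the report. HONEST FRAMING: census / structure results about one cell of the ladder's H2 test on the exclusion side; no case of the Hodge conjecture
is proved; nothing here is a rung; no statement of [Markman 2025] is used; nothing here depends on (LP) or on 'ker ob = ann(ch)'.

THEOREM J (report §1). On the Jacobian of a non-hyperelliptic, non-bielliptic curve `C` of genus 4 and for `b ≠ 0`: the singular points of `W_b` are
governed by the OVERLAP `o = deg min(D, D′)` of the divisors `D ∈ |L|`, `D′ ∈ |L − b|` at a common smooth point `L` (tangency iff `max(D, D′)`, of degree
`6 − o`, lies in a plane of `ℙ³` — Kempf): `o = 0` iff `2L ≡ K + b` (the `ι`-fixed points; `plane_section_degree`), `o = 1` ↔ the finite set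
`W₂ ∩ (W₂ + b)` (`W2_selfintersection`: `[W₂]² = 6` when finite), `o = 2` ⟹ `b ∈ C − C` (`overlap_trichotomy`). PROPOSITION 1.3: `W₂ ∩ (W₂ + b)`
contains a curve iff `b ∈ (C − C) ∪ {±(g − h)}` (pencils of planes through a secant line; monodromy primitive / base point / imprimitive = bielliptic).
Hence the TRICHOTOMY: `b ∈ C − C` — `W_b = (W₂ + p) ∪ (K − q − W₂)` reducible, non-normal; `b = ±(g − h)` — `W_b = g + (C − C)`, the DIFFERENCE SURFACE,
a theta complete intersection (`difference_surface_class`: `[C − C] = θ²`), integral, normal, one singular point of multiplicity `2g − 2 = 6`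
(`vertex_multiplicity`); otherwise `W_b` is integral and NORMAL with finitely many singular points. COROLLARY J′: a torsion point `b = p − q ≠ 0` of
order `m` would give a degree-`m` cover of `ℙ¹` totally ramified at `p`, `q`: Riemann–Hurwitz leaves ramification index `8` (`hurwitz_budget`), at most
`10` branch points, a family of dimension `≤ 7 < 9 = dim M₄` (`hurwitz_dimension`); the bielliptic and hyperelliptic loci have dimensions `6`, `7`
(`special_loci_dimension`). So on a general curve every non-zero torsion `b` has `W_b` normal.

THEOREM N (report §2). The bad loci `Z_m ⊂ 𝒜₄` ('some `b` of order `m` has `Θ ∩ Θ_b` non-normal') are closed (level cover, fibrewise regular sequence ⟹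
flat, EGA IV 12.2.4) and miss the general Jacobian, hence are nowhere dense (`𝒜₄` irreducible); with PROPOSITION 4.5 and the non-reduced supplement
(`nonreduced_component_class`: a multiple component of `S_a` has `c ≤ 3`, so `ord(2a) ∈ {2,3}`), every ppav fourfold with `Θ` smooth, `End = ℤ`,
outside `Z₂ ∪ … ∪ Z₉` has `Θ_c ∩ Θ_{c′}` integral and normal for all `c ≠ c′`: (Nrm) of the census holds, (Nrm)^c_tors = ∅, and THEOREM 1 of the companion
file holds for EVERY `a ∉ X[2]`. The Hilbert scheme of a Jacobian fourfold at a normal theta c.i. has tangent space of dimension `4 + 4 = 8` = (choice of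
`b`) + (translations) (`hilbert_dimension_theta_ci`) — the smoothness input of the degeneration mechanism named for the core row (report §3.2; not claimed).

What is NOT here: curves, Jacobians, theta functions, the proofs of THEOREMS J / N (report), (RDP⁺), the curve clause, the core row. 0 unconditional
rungs above the floor.
-/

namespace Literature.AlgebraicGeometry.HodgeTheory

section H2ThetaNormality

/-- OVERLAP TRICHOTOMY, arithmetic core (report §1.2): for effective divisors `D, D′` of degree `3` on the canonical curve with
`o = deg min(D, D′)`, the scheme `max(D, D′) = D + D′ − min(D, D′)` has degree `6 − o`; a plane section has degree `2g − 2 = 6`, so for `o = 0` the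
plane containing `max(D, D′)` cuts exactly `D + D′` (`2L ≡ K + b`: an `ι`-fixed point), for `o = 1` a scheme of degree `5 = 4 + 1`
(the length-4 part `D₁ + D₁′` from `W₂ ∩ (W₂ + b)` plus one point), for `o = 2` the residual points `r ≠ r′` give `b = r − r′ ∈ C − C`, and
`o = 3` is `D = D′`, `b = 0`. [folklore] -/
theorem overlap_trichotomy (o : ℕ) (ho : o ≤ 3) :
    3 + 3 - o = 6 - o ∧ (o = 0 ∨ o = 1 ∨ o = 2 ∨ o = 3) ∧ (o = 0 → 3 + 3 - o = 2 * 4 - 2) := by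
  refine ⟨by omega, by omega, by omega⟩

/-- Degree of a plane section of the canonical curve of genus `g = 4`: `2g − 2 = 6 = 3 + 3`. With overlap `0` the tangency plane must contain the
disjoint divisors `D` and `D′`, of total degree `6`, hence `D + D′` IS the plane section: `D + D′ ∈ |K|`, `2L ≡ K + b` — the point `L` is fixed by
`τ_b : L ↦ K + b − L`, i.e. an `ι`-fixed point of `S_a` (report §1.2, case `o = 0`; H2-ZERO-ONE-3 §4.1 (a) seen from the curve). [folklore] -/
theorem plane_section_degree : 2 * 4 - 2 = (3 : ℕ) + 3 := by norm_num

/-- `[W₂]² = 6` on a genus-4 Jacobian (report §1.2, CONSEQUENCE): Poincaré's formula `[W_d] = θ^{g−d}/(g−d)!` gives `[W₂] = θ²/2`, and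
`θ⁴ = 4! = 24`, so `[W₂]·[W₂ + b] = 24/(2·2) = 6` — the number (with multiplicity) of points of `W₂ ∩ (W₂ + b)` when this set is finite, i.e.
the number of candidate sources of NON-fixed singular `τ_b`-orbits of `W_b`. [folklore] -/
theorem W2_selfintersection : (Nat.factorial 4 : ℚ) / ((Nat.factorial 2) * (Nat.factorial 2)) = 6 := by
  norm_num [Nat.factorial]

/-- `[C − C] = θ²` (report §1.5): the difference map `C × C → J(C)` is birational onto `C − C` (no `g¹₂`) and has the homology class of the sum
map (`−1` acts trivially on `H₂(J, ℤ)`), whose image `W₂ = C^{(2)}` of class `θ²/2` is covered with degree `2`; so `deg_θ (C − C) = 2 · (24/2) = 24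
= deg_θ θ² = deg_θ W_b` (`[W_b] = [Θ]·[Θ_b] = θ²`). Since `W_{g−h} ⊇ g + (C − C)` and both are pure of dimension `2` with the same class, they are
EQUAL: the difference surface is a complete intersection of two theta translates. [folklore] -/
theorem difference_surface_class : (2 : ℚ) * (24 / Nat.factorial 2) = 24 ∧ (24 : ℚ) = 1 * 1 * 24 := by
  norm_num [Nat.factorial]

/-- Multiplicity of the vertex of `C − C` (report §1.5 COROLLARY (a)): the maximal ideal of `J(C)` at `0` pulls back to the ideal of the diagonal
`Δ ⊂ C × C` (the canonical system is base-point free), so the multiplicity is `−Δ² = −(2 − 2g) = 2g − 2 = 6` for `g = 4` — the degree of the canonical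
curve, over which the tangent cone is the cone; in particular the vertex is not a double point (not a rational singularity: the exceptional curve
`Δ ≅ C` has genus `4`). [folklore] -/
theorem vertex_multiplicity : -(2 - 2 * (4 : ℤ)) = 6 ∧ 2 * (4 : ℤ) - 2 = 6 := by norm_num

/-- RIEMANN–HURWITZ BUDGET (report §1.7): a cover `C → ℙ¹` of degree `m ≥ 1` from a curve of genus `4` has total ramification index
`2·4 − 2 + 2m = 6 + 2m`; two points of TOTAL ramification (index `m − 1` each, as for the function with divisor `m(p − q)` when `p − q` is
`m`-torsion) use `2(m − 1)`, leaving index exactly `8` — so at most `8` further branch points, at most `10` in all. [folklore] -/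
theorem hurwitz_budget (m : ℤ) (_hm : 1 ≤ m) : (2 * 4 - 2 + 2 * m) - 2 * (m - 1) = 8 ∧ 2 + 8 = (10 : ℤ) := by
  constructor
  · ring
  · norm_num

/-- HURWITZ DIMENSION COUNT (report §1.7): covers of `ℙ¹` with at most `10` branch points form, by Riemann's existence theorem, families of
dimension `≤ 10`, i.e. `≤ 10 − 3 = 7` modulo `Aut ℙ¹`, and `7 < 9 = 3·4 − 3 = dim M₄`: the general curve of genus `4` admits NO cover with two
points of total ramification, of any degree — so no non-zero TORSION point of its Jacobian lies on the difference surface `C − C`. [folklore] -/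
theorem hurwitz_dimension : 10 - 3 < 3 * 4 - (3 : ℕ) ∧ 3 * 4 - (3 : ℕ) = 9 := by norm_num

/-- The two special loci excluded in THEOREM J have dimension `< 9 = dim M₄` (report §1.7): bielliptic curves of genus `4` are double covers of
elliptic curves branched in `2·4 − 2 − 2·0 = 6` points (`1 + 6 − 1 = 6` moduli: the curve, the branch points, minus translations), hyperelliptic
ones depend on `2·4 − 1 = 7` moduli. [folklore] -/
theorem special_loci_dimension : 2 * 4 - 2 - 2 * 0 = (6 : ℕ) ∧ 1 + 6 - 1 < (9 : ℕ) ∧ 2 * 4 - 1 < (9 : ℕ) := by norm_num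

/-- THE NON-REDUCED SUPPLEMENT to PROPOSITION 4.5 (report §2.3): if `S_a = Θ_a ∩ Θ_{−a}` (class `θ²`, degree `θ⁴ = 24`) had a component `V` of
multiplicity `μ ≥ 2`, then `d_V = V·θ² ≤ 12`; the Hodge class `[V]·θ = c·θ³/6` has `4c = d_V` (`θ⁴/6 = 4`), so `1 ≤ c ≤ 3`, and every component of
`V ∩ Θ_e` has class `k·θ³/6` with `k ≤ c ≤ 3`; by 4.5 (i)–(ii) `2a ∈ X[k]`, `k ≠ 1` (Matsusaka; `Θ` smooth), so `ord(2a) ∈ {2, 3}` — covered by the bad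
loci `Z₂ ∪ Z₃` of THEOREM N. [folklore] -/
theorem nonreduced_component_class (μ d c k : ℕ) (hμ : 2 ≤ μ) (hdeg : μ * d ≤ 24) (hc : 4 * c = d) (hk1 : 1 ≤ k)
    (hkc : k ≤ c) (hk : k ≠ 1) : k = 2 ∨ k = 3 := by
  have hd : d ≤ 12 := by nlinarith
  omega

/-- HILBERT-SCHEME DIMENSION at a normal theta c.i. of a Jacobian fourfold (report §3.2, the smoothness input of the degeneration mechanism named
for the core row — not claimed): `h⁰(N_{W_b}) = h⁰(𝒪_{W_b}(Θ)) + h⁰(𝒪_{W_b}(Θ_b)) = 4 + 4` (from `0 → P_{−b}|_Θ → 𝒪_Θ(Θ) → 𝒪_{W_b}(Θ) → 0`,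
`H^{≤1}(P_{−b}|_Θ) = 0`, `h⁰(𝒪_Θ(Θ)) = h¹(𝒪_X) = 4`), equal to the dimension `4 + 4` of the family `{W_{b′} + c}` (choice of `b′`, translation `c`):
the relative Hilbert scheme is smooth of relative dimension `8` there. [folklore] -/
theorem hilbert_dimension_theta_ci : (4 : ℕ) + 4 = 8 ∧ (1 - 1 + 4 : ℤ) = 4 := by norm_num

end H2ThetaNormality

end Literature.AlgebraicGeometry.HodgeTheory
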